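import Summits.HodgeConjecture.HodgeConjecture.Theses.PadicSemiregularLift

/-!
# `PadicPridhamSemiregularity` (stmt-HodgeConjecture-13815) · Negative · thickening-equivariance of the
p-adic Bloch identity, the Dwork–Ogus witness, and the characteristic-zero transfer

Kernel-checked, `def`-free by-products of the standing disprover's cycle 4
(refuter-cdisprove-stmt-HodgeConjecture-13815-g4-0, 2026-08-16; work file
`Cruxes/PadicPridhamSemiregularity/Disproof.lean` §11). Context: the operative half (ii′) of the informal
crux P1b is an additivity theorem (Disproof §1); what remains of P1b is the `K₀`-free first-step identity
  (β₁)  `q_{X₂}(ch_r^cris E₁) = ε · ι σ_{r-1}(o(E₁; X₂))`  in `H^{2r}(X₁, Ω^{<r})`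
(Hodge defect of the crystalline Chern character at level 2 = image of Illusie's obstruction under the
Buchweitz–Flenner map) and its deeper analogues (β_n).

* **(E) Equivariance skeleton.** The `W₂`-lifts of `X₁` form a torsor under `K = H¹(X₁, T)`; under
  `X₂ ↦ X₂ + κ` the obstruction moves by `o ↦ o + Aκ` (`A = κ ⌟ At(E₁)`, Illusie: the obstruction is the
  Yoneda product of the ABSOLUTE Atiyah class with the class of the extension, and the splittings
  `L_{X₁/W} ≃ Ω¹ ⊕ 𝒪[1]` are exactly the lifts), and the level-2 Hodge defect moves by `q ↦ q − Bκ`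
  (`B = ι(κ ⌟ ch_r^{(r,r)})`, crystalline Kodaira–Spencer / Griffiths transversality at level 2:
  `F^r_{X₂+κ} = (1 + pθ_κ)F^r_{X₂}` inside `H^{2r}_cris(X₁/W₂)`). The Buchweitz–Flenner derivation identity
  `σ_{r-1}(κ ⌟ At) = κ ⌟ ch_r^{(r,r)}` is `S ∘ A = B` (`S = ι ∘ σ_{r-1}`). THEN: the identity with
  `ε = −1` holds at `X₂` iff it holds at `X₂ + κ` (`padicBloch_shift_iff`); the defect
  `Δ = q + S o` is lift-INDEPENDENT (`padicBloch_defect_shift_invariant`); the opposite sign is refuted by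
  the torsor structure (`padicBloch_plus_sign_refuted`) — this FIXES the universal sign left open in
  Disproof §7; and (β₁) HOLDS for every `E₁` that lifts to SOME `W₂`-lift of `X₁`
  (`padicBloch_of_liftsSomewhere`: there `o + Aκ = 0`, and `q − Bκ = 0` is Berthelot–Illusie "the
  crystalline Chern character of a liftable bundle is the de Rham Chern character of the lift, in `F^r`").
  Consequently `Δ_r : K₀(X₁) → H^{2r}(X₁, Ω^{<r})` is a homomorphism (additivity, Disproof §1 (A)) killing
  every class liftable to some `W₂`-model; with the MAP versions of the two transformation rules it is
  natural under all pull-backs and dies on Grassmannians, i.e. (β₁) follows in general (the cards'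
  classifying-map argument, now with no divided powers at all: `p² = 0`).
* **(DO) The Dwork–Ogus witness** (B. Dwork, A. Ogus, *Canonical liftings of Jacobians*, Compositio
  Math. 58 (1986) 111–131, Thm. (1.9), read: for `g ≥ 4`, `p` odd, the pre-`W₂`-canonical ordinary curves
  are nowhere dense — a generic ordinary genus-`g` curve `C` does NOT lift into `J(C)^can ⊗ W₂`; and
  (1.1.3)/(1.4.3), p. 113–115: `H¹_cris = U ⊕ T`, `F¹H¹_dR(A^can/W) = T`, the dual of the canonical lift
  is the canonical lift of the dual, polarisations lift, `A^can` is algebraizable). On `𝒳 = Ĵ(C)^can`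
  (abelian scheme, `d = 4`, Hodge-torsion-free, `Ω¹` free, any `p ≥ 11`) EVERY `φ`-Tate class — hence
  every `ch_r^cris(E₁)` — lies in `Λ^rU ⊗ Λ^rT ⊂ F^r H^{2r}_dR(𝒳/W)` at all levels, integrally; yet the
  Picard bundle `E_d = Φ(𝒪_C(D))` (`deg D ≥ 2g − 1`, Fourier–Mukai over `W₂` commutes with restriction)
  does not lift to `X₂`, because a flat lift of `𝒪_C(D)` is a line bundle on a flat lift of `C` inside
  `J^can ⊗ W₂`. So the strengthening "Hodge at all levels + `H_tf` + smooth projective + `d + 6 < p` ⇒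
  `E₁` lifts to `X₂`" of repaired P1 (semiregularity dropped) is FALSE with a printed witness; the
  object/class gap (⋆) is real there; and semiregularity fails for `E_d` EXACTLY as the mechanism requires:
  Bloch-semiregularity of the Abel–Jacobi curve `C ⊂ J` (`h¹(N_{C/J}) = g² − 3g + 3` for non-hyperelliptic
  `C`, by Noether; receptacle `H^g(J, Ω^{g−2})` of dimension `g(g−1)/2`) is dimensionally possible iff
  `g ≤ 3` (`abelJacobi_semiregular_dimcount_iff`) — the p-adic semiregularity mechanism reproduces the
  Dwork–Ogus genus threshold `g ≥ 4` on the nose, and for `g = 3` non-hyperelliptic it predicts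
  pre-`W_n`-canonicity for all `n`, which holds (Torelli: `Def(C) ≅ Def(J, λ)`, both of dimension 6).
  DIRECT VERIFICATION of (β₁) on the witness (Disproof §11.2 (e)): `σ_q(o(E_d)) = 0` for every `q` although
  `o(E_d) ≠ 0` — by the Fourier–Mukai dictionary (Mukai 1981: `Φ` exchanges translations and `⊗P_x`) the
  Atiyah class of `E_d` becomes `v ↦ i_*(v|_C) ∈ F¹Ext¹_J(𝒪_C(D), 𝒪_C(D))`, the obstruction becomes the
  embedded obstruction in `F¹Ext² = H¹(C, N)`, and the local-to-global filtration on a curve has `F² = 0`: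
  so `At(E_d)² = 0` (equivalently `ch(E_d) = rk − θ̂`, Mattuck–Poincaré), `σ_{≥2} ≡ 0`, `σ₁(o) ↔ F²Ext⁴ = 0`,
  and `σ₀(o) = o(det) = 0` (every line bundle lifts to `A^can_2`: Frobenius lift + `o(L^p) = p·o(L)`). Both
  sides of (β₁) vanish; `E_d` is certified non-semiregular with non-zero obstruction in `ker ⊕σ_q`.
* **(T) Characteristic-zero transfer** (`injective_of_injective_mod`): a linear map of `p`-adically
  separated / `p`-torsion-free modules that is injective mod `p` is injective. Applied to
  `⊕σ_q : Ext²_{𝒳'}(ℰ, ℰ) → ⊕ H^{q+2}(𝒳', Ω^q)` for a `W`-model `(𝒳', ℰ)` of `(X₁, E₁)`: a p-adically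
  semiregular `E₁` that lifts, together with `X₁`, to SOME `W`-model is semiregular in characteristic `0`
  on `𝒳'_K`, where Bloch–Buchweitz–Flenner–Pridham is a theorem. So every counterexample hunt against the
  USE of (β_n) is confined to pairs `(X₁, E₁)` that lift jointly to no `W`-model, and the route's lifted
  seeds are automatically char-0 semiregular sheaves (their classes have "Hodge locus = deformation locus").
-/

set_option linter.dupNamespace false

namespace Summit.HodgeConjecture.HodgeConjecture.Theorems.PadicPridhamSemiregularity.Negative

/-! ## (E) The torsor of `W₂`-lifts acts compatibly on both sides of (β₁) -/

section Equivariance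

variable {K E Q : Type*} [AddCommGroup K] [AddCommGroup E] [AddCommGroup Q]

/-- **The defect of (β₁) is independent of the `W₂`-lift.** With `o' = o + Aκ` (obstruction under change
of thickening), `q' = q − Bκ` (Hodge defect under change of thickening) and `S ∘ A = B` (Buchweitz–Flenner:
`σ_{r-1}(κ ⌟ At) = κ ⌟ ch_r`), the quantity `q + S o` does not move. [folklore] -/
theorem padicBloch_defect_shift_invariant (A : K →+ E) (B : K →+ Q) (S : E →+ Q)
    (hSA : S.comp A = B) (q : Q) (o : E) (κ : K) :
    (q - B κ) + S (o + A κ) = q + S o := by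
  have h : S (A κ) = B κ := by rw [← AddMonoidHom.comp_apply, hSA]
  rw [map_add, h]
  abel

/-- **(β₁) at `X₂` ⟺ (β₁) at `X₂ + κ`, with the sign `ε = −1`** (relative to the conventions in which the
two transformation rules read `o ↦ o + Aκ`, `q ↦ q − Bκ`). [folklore] -/
theorem padicBloch_shift_iff (A : K →+ E) (B : K →+ Q) (S : E →+ Q) (hSA : S.comp A = B)
    (q : Q) (o : E) (κ : K) :
    q - B κ = -S (o + A κ) ↔ q = -S o := by
  have h : S (A κ) = B κ := by rw [← AddMonoidHom.comp_apply, hSA]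
  rw [map_add, h, neg_add', sub_left_inj]

/-- **(β₁) holds for every bundle that lifts to SOME `W₂`-lift of `X₁`.** If `E₁` lifts to `X₂ + κ`
(`o + Aκ = 0`) then its crystalline Chern character is Hodge THERE (`q − Bκ = 0`, Berthelot–Illusie),
and transporting back gives the identity at `X₂`: `q = −S o`. [folklore] -/
theorem padicBloch_of_liftsSomewhere (A : K →+ E) (B : K →+ Q) (S : E →+ Q) (hSA : S.comp A = B)
    (q : Q) (o : E) (κ : K) (hlift : o + A κ = 0) (hHodge : q - B κ = 0) : q = -S o := by
  rw [← padicBloch_shift_iff A B S hSA q o κ, hlift, hHodge, map_zero, neg_zero]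

/-- **The opposite sign is refuted by the torsor structure**: "`q = +S o` at every lift" is
incompatible with the transformation rules as soon as some `Bκ` is not `2`-torsion — model
`K = E = Q = ℤ`, `A = B = S = id`, `q = o = 0`, `κ = 1` (`0 − 1 ≠ 0 + 1`). So the universal sign of the
p-adic Bloch identity is FORCED by (T-ob)/(T-Hodge); it is not a convention to be fixed later. [folklore] -/
theorem padicBloch_plus_sign_refuted :
    ¬ ∀ (K E Q : Type) [AddCommGroup K] [AddCommGroup E] [AddCommGroup Q] (A : K →+ E) (B : K →+ Q)
        (S : E →+ Q), S.comp A = B → ∀ (q : Q) (o : E) (κ : K), q = S o → q - B κ = S (o + A κ) := by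
  intro h
  have h1 := h ℤ ℤ ℤ (AddMonoidHom.id ℤ) (AddMonoidHom.id ℤ) (AddMonoidHom.id ℤ) rfl 0 0 1 rfl
  simp at h1

/-- **The defect is a class function**: if `Δ : K₀ → Q` is additive and kills a subgroup `L` (the classes
liftable to some `W₂`-model), then `Δ x = Δ y` whenever `x − y ∈ L`; in particular (β₁) for `E₁` follows
from (β₁) for any `E₁'` with `[E₁] − [E₁'] ∈ L`. [folklore] -/
theorem defect_eq_of_sub_mem {G : Type*} [AddCommGroup G] (Δ : G →+ Q) (L : AddSubgroup G)
    (hL : ∀ z ∈ L, Δ z = 0) {x y : G} (hxy : x - y ∈ L) : Δ x = Δ y := by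
  have h := hL _ hxy
  rwa [map_sub, sub_eq_zero] at h

end Equivariance

/-! ## (T) Characteristic-zero transfer: injective mod `p` ⇒ injective -/

section Transfer

variable {R : Type*} [CommRing R] {M N : Type*} [AddCommGroup M] [AddCommGroup N] [Module R M]
  [Module R N]

/-- **Injective mod `p` ⇒ injective**, for a linear map from a `p`-adically separated module to a
`p`-torsion-free one. USE: `M = Ext²_{𝒳'/W}(ℰ, ℰ)` (finitely generated over `W`, hence separated),
`N = ⊕_q H^{q+2}(𝒳', Ω^q)` (free under Hodge-torsion-freeness), `f = ⊕σ_q`; "injective mod `p`" is implied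
by p-adic semiregularity of `E₁ = ℰ|X₁` because `M/pM ↪ Ext²_{X₁}(E₁, E₁)` (base change for `Ext`)
compatibly with `σ`. Conclusion: `f ⊗ K` is injective — `ℰ_K` is semiregular in characteristic `0`.
[folklore] -/
theorem injective_of_injective_mod (p : R) (f : M →ₗ[R] N)
    (hsep : ∀ m : M, (∀ n : ℕ, ∃ m' : M, m = p ^ n • m') → m = 0)
    (htf : ∀ x : N, p • x = 0 → x = 0)
    (hmod : ∀ m : M, (∃ x : N, f m = p • x) → ∃ m' : M, m = p • m') :
    Function.Injective f := by
  rw [injective_iff_map_eq_zero]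
  intro m hm
  apply hsep
  intro n
  induction n generalizing m with
  | zero => exact ⟨m, by rw [pow_zero, one_smul]⟩
  | succ n ih =>
    obtain ⟨m', rfl⟩ := hmod m ⟨0, by rw [hm, smul_zero]⟩
    have hm' : f m' = 0 := htf _ (by rw [← map_smul]; exact hm)
    obtain ⟨m'', hm''⟩ := ih m' hm'
    exact ⟨m'', by rw [hm'', smul_smul, ← pow_succ']⟩

/-- … and `p`-torsion-freeness of the target cannot be dropped: `ℤ → ℤ/p`, reduction, is injective mod
`p` in the above sense on the separated module `ℤ` but not injective (model `p = 2`). In the application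
this is the Bockstein/torsion in `H^{q+2}(𝒳', Ω^q)`, i.e. once more `H_tf`. [folklore] -/
theorem not_injective_of_injective_mod_without_torsionFree :
    ¬ Function.Injective (Int.castAddHom (ZMod 2)) := by
  intro h
  have h2 : Int.castAddHom (ZMod 2) 2 = Int.castAddHom (ZMod 2) 0 := by decide
  exact absurd (h h2) (by decide)

end Transfer

/-! ## (DO) The Dwork–Ogus threshold is the semiregularity threshold of the Abel–Jacobi curve -/

section DworkOgus

/-- **Bloch-semiregularity of `C ⊂ J(C)` is dimensionally possible iff `g ≤ 3`.** For a non-hyperelliptic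
curve of genus `g ≥ 2`... (for `g = 2` every curve is hyperelliptic; read the statement for `g ≥ 3`, and for
`g = 2` as the count with `h⁰(N) = g`): `h¹(N_{C/J}) = g·g − (3g − 3) = g² − 3g + 3` (Euler sequence
`0 → T_C → 𝒪_C^g → N → 0`, `H¹(T_C) ↪ H¹(𝒪_C) ⊗ H⁰(K_C)^∨` by Noether), while Bloch's receptacle for a
codimension-`(g−1)` cycle is `H^g(J, Ω^{g−2}_J)`, of dimension `binom(g, 2) = g(g−1)/2`. Injectivity of
`π_C` needs `g² − 3g + 3 ≤ g(g−1)/2`, i.e. `(g−2)(g−3) ≤ 0`. So for `g ≥ 4` the Abel–Jacobi curve (and with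
it `𝒪_C`, and the Picard bundles `Φ(𝒪_C(D))`) is NEVER semiregular — exactly the range of Dwork–Ogus'
Theorem (1.9) (generic ordinary `C` does not lift into `J^can ⊗ W₂`), so the Dwork–Ogus bundles refute
"Hodge at all levels + `H_tf` ⇒ lifts" but cannot touch "semiregular + Hodge + `H_tf` ⇒ lifts"; for `g = 3`
the count is tight and the mechanism predicts pre-`W_n`-canonicity of non-hyperelliptic ordinary genus-3
curves, which is true (`Def(C) ≅ Def(J, λ)`). [folklore] -/
theorem abelJacobi_semiregular_dimcount_iff (g : ℤ) (hg : 2 ≤ g) :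
    2 * (g ^ 2 - 3 * g + 3) ≤ g * (g - 1) ↔ g ≤ 3 := by
  constructor
  · intro h
    by_contra h4
    push Not at h4
    nlinarith
  · intro h3
    interval_cases g <;> norm_num

/-- The genus-4 instance used for the witness: `h¹(N_{C/J}) = 7 > 6 = h⁴(J, Ω²_J)`. [folklore] -/
theorem abelJacobi_genus_four_count : (4 : ℤ) ^ 2 - 3 * 4 + 3 = 7 ∧ (4 : ℤ) * (4 - 1) / 2 = 6 := by
  norm_num

end DworkOgus

end Summit.HodgeConjecture.HodgeConjecture.Theorems.PadicPridhamSemiregularity.Negative
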